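import Summits.CriticalPhenomena.CardyFormulaZ2.Theorems.CardySusyWardParafermionFamiliesToSLESixAnchorMesh

/-!
# The strip anchor (stub S5 of line `strip-anchored-vertex-normalisation`, crux stmt-CriticalPhenomena-10814), IV:
# the discrete arcs of the anchor family and the geometry package `S5.anchor_geometry`

Helper file for `stub_anchoredWallFlux` (stub GEOMETRY, part 2). For a discretisation family `Λ` of the
anchor Dobrushin domain with the six `IsFamily` fields (`…AnchorFamily.lean`), eventually as `δ → 0⁺`:
the data `Λ δ` is admissible, lives on the anchor square at mesh `δ`, and with `L = ⌈2/δ⌉ - 1`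
(`L δ < 2 ≤ (L + 1) δ`) its discrete domain, `Ω_δ`-adjacency, discrete boundary and inner faces are the
explicit lattice sets of `…AnchorMesh.lean`, while the Hausdorff convergence of the arcs
(`arcA → arc 0` = the three wired sides, `arcB → arc 1` = the free side `{x + y = 2}`) pins the discrete
arcs near the free wall: a boundary site of level `s = v₀ + v₁ ≥ L - 1` in the middle half
`4 |v₀ - v₁| ≤ 3 L` of the free side lies on `zdArcB` and off `zdArcA` (`not_mem_zdArcA_of_near`), and a
boundary site of level `4 s ≤ 3 L` lies on `zdArcA` and off `zdArcB` (`not_mem_zdArcB_of_far`): the mesh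
point is within `2δ` of a frontier point of the "right" arc and at distance `≥ 1/8` from the other
discrete arc once both Hausdorff distances are `< 1/8` and `δ < 1/16`. Assembled in `S5.anchor_geometry`.
Also the registered one-line form `stub_anchor_lattice` (a `2`-neighbourhood of a site moves its mesh
point by less than `4δ`).
-/

noncomputable section

namespace Summit.CriticalPhenomena.CardyFormulaZ2.Theorems.ParafermionFamiliesToSLESix.StripAnchored

open Filter Set Metric Complex
open scoped Topology ENNReal
open Literature.Probability.LatticeModels
open Literature.Probability.RandomPlanarGeometry
open Summit.CriticalPhenomena.CardyFormulaZ2.Theorems.ParafermionPrecompact.Negative (IsFamily)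

namespace S5

/-! ## The wired arc, the frontier, distances -/

/-- **The wired arc `arc 0` of the anchor lies on the three sides** `{x + y = -2}`, `{|x - y| = 2}`.
[folklore] -/
theorem re_im_of_mem_arc_zero {z : ℂ} (hz : z ∈ anchorDomain.arc 0) :
    z.re + z.im = -2 ∨ |z.re - z.im| = 2 := by
  rw [anchorDomain, MarkedDomain.arc_map, MarkedDomain.arc, nextMark_base.2] at hz
  change z ∈ rotHomeo '' (polygonLoop (rectVerts 1 1) '' Icc ((![0, 3 / 4] : Fin 2 → ℝ) 0) (3 / 4)) at hz
  simp only [Matrix.cons_val_zero] at hz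
  obtain ⟨u, ⟨t, ht, rfl⟩, rfl⟩ := hz
  set p := polygonLoop (rectVerts 1 1) t with hp
  rw [rotHomeo_apply, rotC_mul_re, rotC_mul_im,
    show p.im - p.re + -(p.re + p.im) = -2 * p.re by ring,
    show p.im - p.re - -(p.re + p.im) = 2 * p.im by ring]
  rcases baseLoop_arc_zero ht with h | h | h
  · right; rw [h]; norm_num
  · left; rw [h]; norm_num
  · right; rw [h]; norm_num

/-- The frontier of the anchor square is the image of the frontier of the axis square. [folklore] -/
theorem frontier_anchorDomain_carrier_eq :
    frontier anchorDomain.carrier = rotHomeo '' frontier (symRect 1 1) := by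
  rw [anchorDomain_carrier_eq, ← Homeomorph.image_frontier]

/-- **Points of the four sides are frontier points** of the anchor square. [folklore] -/
theorem mem_frontier_anchor {q : ℂ}
    (h : (|q.re + q.im| ≤ 2 ∧ |q.re - q.im| = 2) ∨ (|q.re + q.im| = 2 ∧ |q.re - q.im| ≤ 2)) :
    q ∈ frontier anchorDomain.carrier := by
  rw [frontier_anchorDomain_carrier_eq]
  refine ⟨⟨-(q.re + q.im) / 2, (q.re - q.im) / 2⟩, ?_, ?_⟩
  · rw [mem_frontier_symRect one_pos one_pos]
    rcases h with ⟨h1, h2⟩ | ⟨h1, h2⟩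
    · left
      rw [abs_le] at h1
      rcases (abs_eq (by norm_num : (0:ℝ) ≤ 2)).1 h2 with h2 | h2
      · exact ⟨⟨by linarith, by linarith⟩, Or.inr (by simp only; linarith)⟩
      · exact ⟨⟨by linarith, by linarith⟩, Or.inl (by simp only; linarith)⟩
    · right
      rw [abs_le] at h2
      rcases (abs_eq (by norm_num : (0:ℝ) ≤ 2)).1 h1 with h1 | h1
      · exact ⟨Or.inl (by simp only; linarith), by simp only; constructor <;> linarith⟩
      · exact ⟨Or.inr (by simp only; linarith), by simp only; constructor <;> linarith⟩
  · rw [rotHomeo_apply]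
    apply Complex.ext
    · rw [rotC_mul_re]; ring
    · rw [rotC_mul_im]; ring

/-- A point of level `re + im ≥ 1` and column `|re - im| < 3/2` is at distance `> 1/4` from the wired arc
(its lateral sides `|x - y| = 2` and its bottom side `x + y = -2`). [folklore] -/
theorem dist_gt_of_mem_arc_zero {z a : ℂ} (ha : a ∈ anchorDomain.arc 0) (h1 : 1 ≤ z.re + z.im)
    (h2 : |z.re - z.im| < 3 / 2) : 1 / 4 < dist z a := by
  -- `|Δre|, |Δim| ≤ dist` (`SSContinuity.abs_re_im_le_dist` of `QuadLowestCrossingProofs.lean`, inlined)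
  have hr : |z.re - a.re| ≤ dist z a := by
    rw [Complex.dist_eq]; simpa using Complex.abs_re_le_norm (z - a)
  have hi : |z.im - a.im| ≤ dist z a := by
    rw [Complex.dist_eq]; simpa using Complex.abs_im_le_norm (z - a)
  rw [abs_le] at hr hi
  rw [abs_lt] at h2
  rcases re_im_of_mem_arc_zero ha with h | h
  · linarith
  · rcases (abs_eq (by norm_num : (0:ℝ) ≤ 2)).1 h with h | h <;> linarith

/-- A point of level `re + im ≤ 3/2` is at distance `≥ 1/4` from the free side `arc 1 = {x + y = 2}`.
[folklore] -/
theorem dist_ge_of_mem_arc_one {z b : ℂ} (hb : b ∈ anchorDomain.arc 1) (h1 : z.re + z.im ≤ 3 / 2) :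
    1 / 4 ≤ dist z b := by
  have hr : |z.re - b.re| ≤ dist z b := by
    rw [Complex.dist_eq]; simpa using Complex.abs_re_le_norm (z - b)
  have hi : |z.im - b.im| ≤ dist z b := by
    rw [Complex.dist_eq]; simpa using Complex.abs_im_le_norm (z - b)
  rw [abs_le] at hr hi
  have := (mem_anchorDomain_arc_one.1 hb).1
  linarith

variable {E : DiscreteDobrushin} {δ : ℝ} {L : ℤ}

/-- If `arcA` is Hausdorff-`1/8`-close to the wired arc, a point of level `≥ 1` and column `< 3/2` is at
distance `> 1/8` from every point of `arcA`. [folklore] -/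
theorem dist_arcA_gt (hA : hausdorffEDist E.arcA (anchorDomain.arc 0) < ENNReal.ofReal (1 / 8)) {z : ℂ}
    (h1 : 1 ≤ z.re + z.im) (h2 : |z.re - z.im| < 3 / 2) : ∀ a ∈ E.arcA, 1 / 8 < dist z a := by
  intro a ha
  obtain ⟨a', ha', haa'⟩ := exists_edist_lt_of_hausdorffEDist_lt ha hA
  rw [edist_lt_ofReal] at haa'
  have := dist_gt_of_mem_arc_zero ha' h1 h2
  linarith [dist_triangle z a a']

/-- If `arcB` is Hausdorff-`1/8`-close to the free side, a point of level `≤ 3/2` is at distance `> 1/8`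
from every point of `arcB`. [folklore] -/
theorem dist_arcB_gt (hB : hausdorffEDist E.arcB (anchorDomain.arc 1) < ENNReal.ofReal (1 / 8)) {z : ℂ}
    (h1 : z.re + z.im ≤ 3 / 2) : ∀ b ∈ E.arcB, 1 / 8 < dist z b := by
  intro b hb
  obtain ⟨b', hb', hbb'⟩ := exists_edist_lt_of_hausdorffEDist_lt hb hB
  rw [edist_lt_ofReal] at hbb'
  have := dist_ge_of_mem_arc_one hb' h1
  linarith [dist_triangle z b b']

/-- A set Hausdorff-close to a nonempty set is nonempty. [folklore] -/
theorem anchor_nonempty_of_hausdorffEDist_lt {s t : Set ℂ} {r : ℝ≥0∞} (h : hausdorffEDist s t < r) (ht : t.Nonempty) :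
    s.Nonempty :=
  nonempty_of_hausdorffEDist_ne_top ht (by rw [hausdorffEDist_comm]; exact ne_top_of_lt h)

/-- The diagonal shift `p ↦ p + t (1 + i)`: level `+ 2t`, same column, length `≤ 2 |t|`. [folklore] -/
theorem anchor_shift_diag (p : ℂ) (t : ℝ) :
    ((p + t * (1 + I)).re + (p + t * (1 + I)).im = p.re + p.im + 2 * t) ∧
      ((p + t * (1 + I)).re - (p + t * (1 + I)).im = p.re - p.im) ∧
      dist p (p + t * (1 + I)) ≤ 2 * |t| := by
  refine ⟨by simp; ring, by simp, ?_⟩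
  rw [dist_eq_norm', add_sub_cancel_left, norm_mul, Complex.norm_real, Real.norm_eq_abs]
  have h2 : ‖(1 : ℂ) + I‖ ≤ 2 := (norm_add_le _ _).trans (by norm_num [Complex.norm_I])
  nlinarith [abs_nonneg t, norm_nonneg ((1 : ℂ) + I)]

/-- The anti-diagonal shift `p ↦ p + t (1 - i)`: same level, column `+ 2t`, length `≤ 2 |t|`. [folklore] -/
theorem anchor_shift_anti (p : ℂ) (t : ℝ) :
    ((p + t * (1 - I)).re + (p + t * (1 - I)).im = p.re + p.im) ∧
      ((p + t * (1 - I)).re - (p + t * (1 - I)).im = p.re - p.im + 2 * t) ∧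
      dist p (p + t * (1 - I)) ≤ 2 * |t| := by
  refine ⟨by simp; ring, by simp; ring, ?_⟩
  rw [dist_eq_norm', add_sub_cancel_left, norm_mul, Complex.norm_real, Real.norm_eq_abs]
  have h2 : ‖(1 : ℂ) - I‖ ≤ 2 := (norm_sub_le _ _).trans (by norm_num [Complex.norm_I])
  nlinarith [abs_nonneg t, norm_nonneg ((1 : ℂ) - I)]

/-- Level and column of a mesh point. [folklore] -/
theorem anchor_meshPoint_level_column (δ : ℝ) (v : Site 2) :
    (meshPoint δ v).re + (meshPoint δ v).im = δ * ((v 0 : ℝ) + v 1) ∧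
      (meshPoint δ v).re - (meshPoint δ v).im = δ * ((v 0 : ℝ) - v 1) := by
  rw [meshPoint_re, meshPoint_im]; constructor <;> ring

/-! ## The discrete arcs near and far from the free wall -/

/-- **Near the middle of the free side a boundary site is off the discrete wired arc**: for a site of
level `s ∈ {L - 1, L}` and column `4 |d| ≤ 3 L`, its mesh point `p` (level `δ s ∈ [2 - 2δ, 2)`, column
`|δ d| < 3/2`) is within `2δ < 1/8` of the free-side point above it, which is a frontier point off
`arcA`, while every point of `arcA` is at distance `> 1/8`; so `p` is strictly closer to `∂Ω ∖ arcA`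
than to `arcA`. [folklore] -/
theorem not_mem_zdArcA_of_near (hΩ : E.Ω = anchorDomain.carrier) (hE : E.δ = δ) (hδ : 0 < δ)
    (hδs : δ < 1 / 16) (hLδ : (L : ℝ) * δ < 2) (hL1 : 2 ≤ ((L : ℝ) + 1) * δ)
    (hA : hausdorffEDist E.arcA (anchorDomain.arc 0) < ENNReal.ofReal (1 / 8)) {v : Site 2}
    (hsL : v 0 + v 1 ≤ L) (hs : L - 1 ≤ v 0 + v 1) (hd : 4 * |v 0 - v 1| ≤ 3 * L) : v ∉ E.zdArcA := by
  rw [DiscreteDobrushin.zdArcA, DiscreteDobrushin.mem_zdDiscreteArc_iff, hΩ, hE, not_and, not_le]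
  intro _
  obtain ⟨hpre, hpim⟩ := anchor_meshPoint_level_column δ v
  set p := meshPoint δ v with hp
  have hsL' : (v 0 : ℝ) + v 1 ≤ L := by exact_mod_cast hsL
  have hs' : (L : ℝ) - 1 ≤ (v 0 : ℝ) + v 1 := by exact_mod_cast hs
  have hd' : 4 * |(v 0 : ℝ) - v 1| ≤ 3 * L := by exact_mod_cast hd
  have hσ1 : 2 - 2 * δ ≤ p.re + p.im := by rw [hpre]; nlinarith
  have hσ2 : p.re + p.im < 2 := by rw [hpre]; nlinarith
  have hτ : |p.re - p.im| < 3 / 2 := by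
    rw [hpim, abs_mul, abs_of_pos hδ]
    nlinarith [abs_nonneg ((v 0 : ℝ) - v 1)]
  -- the foot `q` of `p` on the free side
  obtain ⟨hq1, hq2, hq3⟩ := anchor_shift_diag p ((2 - (p.re + p.im)) / 2)
  set q := p + (((2 - (p.re + p.im)) / 2 : ℝ) : ℂ) * (1 + I) with hq
  have hqlev : q.re + q.im = 2 := by rw [hq1]; ring
  have hqarc : q ∈ anchorDomain.arc 1 :=
    mem_anchorDomain_arc_one.2 ⟨hqlev, by rw [hq2]; linarith [hτ.le]⟩
  have hqA : q ∉ E.arcA := fun h => by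
    have := dist_arcA_gt hA (z := q) (by linarith) (by rw [hq2]; exact hτ) q h
    rw [dist_self] at this
    linarith
  have hup : infDist p (frontier anchorDomain.carrier \ E.arcA) ≤ 2 * δ := by
    refine (infDist_le_dist_of_mem
      (mem_sdiff_of_mem (anchorDomain.arc_subset_frontier 1 hqarc) hqA)).trans (hq3.trans ?_)
    rw [abs_of_nonneg (by linarith)]
    linarith
  have h0ne : (anchorDomain.arc 0).Nonempty := ⟨_, anchorDomain.pt_mem_arc_self 0⟩
  have hAne : E.arcA.Nonempty := anchor_nonempty_of_hausdorffEDist_lt hA h0ne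
  have hlow : 1 / 8 ≤ infDist p E.arcA :=
    (le_infDist hAne).2 fun a ha => (dist_arcA_gt hA (by linarith) hτ a ha).le
  linarith

/-- **Away from the free side a boundary site is off the discrete free arc**: for a boundary site of
level `4 s ≤ 3 L` (so `s ≤ -(L - 1)` or `|d| ≥ L - 1`, the level-`(L-1)` layer being excluded by
`L ≥ 8`), its mesh point `p` (level `≤ 3/2`) is within `2δ < 1/8` of the bottom side or of a lateral
side — frontier points of level `≤ 3/2`, hence off `arcB` — while every point of `arcB` is at distance
`> 1/8`. [folklore] -/
theorem not_mem_zdArcB_of_far (hΩ : E.Ω = anchorDomain.carrier) (hE : E.δ = δ) (hδ : 0 < δ)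
    (hδs : δ < 1 / 16) (hL : 8 ≤ L) (hLδ : (L : ℝ) * δ < 2) (hL1 : 2 ≤ ((L : ℝ) + 1) * δ)
    (hB : hausdorffEDist E.arcB (anchorDomain.arc 1) < ENNReal.ofReal (1 / 8)) {v : Site 2}
    (hsd : |v 0 + v 1| ≤ L ∧ |v 0 - v 1| ≤ L) (hbd : L - 1 ≤ |v 0 + v 1| ∨ L - 1 ≤ |v 0 - v 1|)
    (hs : 4 * (v 0 + v 1) ≤ 3 * L) : v ∉ E.zdArcB := by
  rw [DiscreteDobrushin.zdArcB, DiscreteDobrushin.mem_zdDiscreteArc_iff, hΩ, hE, not_and, not_le]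
  intro _
  obtain ⟨hpre, hpim⟩ := anchor_meshPoint_level_column δ v
  set p := meshPoint δ v with hp
  have hs' : 4 * ((v 0 : ℝ) + v 1) ≤ 3 * L := by exact_mod_cast hs
  have hL' : (8 : ℝ) ≤ L := by exact_mod_cast hL
  have hσ : p.re + p.im < 3 / 2 := by rw [hpre]; nlinarith
  have h1ne : (anchorDomain.arc 1).Nonempty := ⟨_, anchorDomain.pt_mem_arc_self 1⟩
  have hBne : E.arcB.Nonempty := anchor_nonempty_of_hausdorffEDist_lt hB h1ne
  have hlow : 1 / 8 ≤ infDist p E.arcB :=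
    (le_infDist hBne).2 fun b hb => (dist_arcB_gt hB hσ.le b hb).le
  -- a frontier point `q` of level `≤ 3/2` within `2δ` of `p`
  obtain ⟨q, hqf, hqσ, hdist⟩ : ∃ q : ℂ, q ∈ frontier anchorDomain.carrier ∧ q.re + q.im ≤ 3 / 2 ∧
      dist p q ≤ 2 * δ := by
    have hcase : v 0 + v 1 ≤ 1 - L ∨ L - 1 ≤ v 0 - v 1 ∨ v 0 - v 1 ≤ 1 - L := by
      obtain ⟨h1, h2⟩ := hsd
      simp only [abs_le, le_abs'] at h1 h2 hbd
      omega
    obtain ⟨h1, h2⟩ := hsd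
    rw [abs_le] at h1 h2
    have h1a : -(L : ℝ) ≤ (v 0 : ℝ) + v 1 := by exact_mod_cast h1.1
    have h1b : (v 0 : ℝ) + v 1 ≤ L := by exact_mod_cast h1.2
    have h2a : -(L : ℝ) ≤ (v 0 : ℝ) - v 1 := by exact_mod_cast h2.1
    have h2b : (v 0 : ℝ) - v 1 ≤ L := by exact_mod_cast h2.2
    have hσlo : -2 < p.re + p.im := by rw [hpre]; nlinarith
    have hτlo : -2 < p.re - p.im := by rw [hpim]; nlinarith
    have hτhi : p.re - p.im < 2 := by rw [hpim]; nlinarith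
    rcases hcase with hc | hc | hc
    · -- the bottom side
      have hc' : (v 0 : ℝ) + v 1 ≤ 1 - L := by exact_mod_cast hc
      have hσhi : p.re + p.im ≤ -2 + 2 * δ := by rw [hpre]; nlinarith
      obtain ⟨hq1, hq2, hq3⟩ := anchor_shift_diag p ((-2 - (p.re + p.im)) / 2)
      refine ⟨_, mem_frontier_anchor (Or.inr ⟨?_, ?_⟩), by rw [hq1]; linarith, hq3.trans ?_⟩
      · rw [hq1, show p.re + p.im + 2 * ((-2 - (p.re + p.im)) / 2) = -2 by ring]; norm_num
      · rw [hq2, abs_le]; constructor <;> linarith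
      · rw [abs_of_nonpos (by linarith)]; linarith
    · -- the lateral side `x - y = 2`
      have hc' : (L : ℝ) - 1 ≤ (v 0 : ℝ) - v 1 := by exact_mod_cast hc
      have hτ : 2 - 2 * δ ≤ p.re - p.im := by rw [hpim]; nlinarith
      obtain ⟨hq1, hq2, hq3⟩ := anchor_shift_anti p ((2 - (p.re - p.im)) / 2)
      refine ⟨_, mem_frontier_anchor (Or.inl ⟨?_, ?_⟩), by rw [hq1]; linarith, hq3.trans ?_⟩
      · rw [hq1, abs_le]; constructor <;> linarith
      · rw [hq2, show p.re - p.im + 2 * ((2 - (p.re - p.im)) / 2) = 2 by ring]; norm_num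
      · rw [abs_of_nonneg (by linarith)]; linarith
    · -- the lateral side `x - y = -2`
      have hc' : (v 0 : ℝ) - v 1 ≤ 1 - L := by exact_mod_cast hc
      have hτ : p.re - p.im ≤ -2 + 2 * δ := by rw [hpim]; nlinarith
      obtain ⟨hq1, hq2, hq3⟩ := anchor_shift_anti p ((-2 - (p.re - p.im)) / 2)
      refine ⟨_, mem_frontier_anchor (Or.inl ⟨?_, ?_⟩), by rw [hq1]; linarith, hq3.trans ?_⟩
      · rw [hq1, abs_le]; constructor <;> linarith
      · rw [hq2, show p.re - p.im + 2 * ((-2 - (p.re - p.im)) / 2) = -2 by ring]; norm_num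
      · rw [abs_of_nonpos (by linarith)]; linarith
  have hqB : q ∉ E.arcB := fun h => by
    have := dist_arcB_gt hB hqσ q h
    rw [dist_self] at this
    linarith
  have hup : infDist p (frontier anchorDomain.carrier \ E.arcB) ≤ 2 * δ :=
    (infDist_le_dist_of_mem (mem_sdiff_of_mem hqf hqB)).trans hdist
  linarith

/-! ## The geometry package of the anchor family -/

/-- **The lattice geometry of the anchor discretisation family, eventually in the mesh.** For a family
`Λ` with the six `IsFamily` fields on the anchor, for all small `δ > 0`, with `L = ⌈2/δ⌉ - 1`: `Λ δ` is
admissible Dobrushin data on the anchor square at mesh `δ`; its discrete domain is the lattice diamond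
`{|s| ≤ L, |d| ≤ L}` (`s = v₀ + v₁`, `d = v₀ - v₁`) with full lattice adjacency; its discrete boundary
is the layer `L - 1 ≤ |s| ∨ L - 1 ≤ |d|`; the face `f` is inner iff `|f₀ + f₁ + 1| < L ∧ |f₀ - f₁| < L`;
the boundary sites of level `≥ L - 1` in the middle half of the free side lie on the discrete FREE arc
`zdArcB` only, and the boundary sites of level `≤ 3L/4` on the discrete WIRED arc `zdArcA` only.
[folklore] -/
theorem anchor_geometry {Λ : ℝ → DiscreteDobrushin} (hΛ : IsFamily anchorDomain Λ) :
    ∀ᶠ δ in 𝓝[>] (0:ℝ), ∃ L : ℤ, 8 ≤ L ∧ (L : ℝ) * δ < 2 ∧ 2 ≤ ((L : ℝ) + 1) * δ ∧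
      (Λ δ).IsZdAdmissible ∧ (Λ δ).δ = δ ∧ (Λ δ).Ω = anchorDomain.carrier ∧
      (∀ v : Site 2, v ∈ meshDomain (Λ δ).Ω δ ↔ |v 0 + v 1| ≤ L ∧ |v 0 - v 1| ≤ L) ∧
      (∀ v u : Site 2, v ∈ meshDomain (Λ δ).Ω δ → u ∈ meshDomain (Λ δ).Ω δ → (zdGraph 2).Adj v u →
        (discreteDomainGraph (Λ δ).Ω δ).Adj v u) ∧
      (∀ v : Site 2, v ∈ (Λ δ).zdBoundary ↔
        (|v 0 + v 1| ≤ L ∧ |v 0 - v 1| ≤ L) ∧ (L - 1 ≤ |v 0 + v 1| ∨ L - 1 ≤ |v 0 - v 1|)) ∧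
      (∀ f : Site 2, (Λ δ).IsInnerFace f ↔ |f 0 + f 1 + 1| < L ∧ |f 0 - f 1| < L) ∧
      (∀ v : Site 2, v ∈ (Λ δ).zdBoundary → L - 1 ≤ v 0 + v 1 → 4 * |v 0 - v 1| ≤ 3 * L →
        v ∈ (Λ δ).zdArcB ∧ v ∉ (Λ δ).zdArcA) ∧
      (∀ v : Site 2, v ∈ (Λ δ).zdBoundary → 4 * (v 0 + v 1) ≤ 3 * L → v ∈ (Λ δ).zdArcA ∧ v ∉ (Λ δ).zdArcB) := by
  obtain ⟨hΩ, hδ', hA, hB, -, hadm⟩ := hΛ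
  have h8 : (0 : ℝ≥0∞) < ENNReal.ofReal (1 / 8) := ENNReal.ofReal_pos.2 (by norm_num)
  filter_upwards [hadm, hA.eventually (gt_mem_nhds h8), hB.eventually (gt_mem_nhds h8),
    Ioo_mem_nhdsGT (show (0:ℝ) < 1 / 16 by norm_num)] with δ hadmδ hAδ hBδ hδδ
  obtain ⟨hδ0, hδs⟩ := hδδ
  set L : ℤ := ⌈2 / δ⌉ - 1 with hL
  have hLδ : (L : ℝ) * δ < 2 := by
    have : (L : ℝ) < 2 / δ := by
      rw [hL]; push_cast; linarith [Int.ceil_lt_add_one (2 / δ)]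
    rwa [lt_div_iff₀ hδ0] at this
  have hL1 : 2 ≤ ((L : ℝ) + 1) * δ := by
    have : 2 / δ ≤ (L : ℝ) + 1 := by
      rw [hL]; push_cast; linarith [Int.le_ceil (2 / δ)]
    rwa [div_le_iff₀ hδ0] at this
  have hL8 : 8 ≤ L := by
    have h32 : (32 : ℝ) < (L : ℝ) + 1 := by nlinarith
    have : (31 : ℤ) < L := by exact_mod_cast (show (31 : ℝ) < L by linarith)
    omega
  have hL2 : 2 ≤ L := by omega
  refine ⟨L, hL8, hLδ, hL1, hadmδ, hδ' δ, hΩ δ, ?_, ?_, ?_, ?_, ?_, ?_⟩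
  · intro v
    rw [hΩ δ]
    exact mem_meshDomain_anchor_iff hδ0 hLδ hL1 v
  · intro v u hv hu hvu
    rw [hΩ δ] at hv hu ⊢
    exact adj_anchor v u hv hu hvu
  · intro v
    exact mem_zdBoundary_anchor_iff (hΩ δ) (hδ' δ) hδ0 hL2 hLδ hL1 v
  · intro f
    exact isInnerFace_anchor_iff (hΩ δ) (hδ' δ) hδ0 hLδ hL1 f
  · intro v hv hs hd
    have hbd := (mem_zdBoundary_anchor_iff (hΩ δ) (hδ' δ) hδ0 hL2 hLδ hL1 v).1 hv
    have hsL : v 0 + v 1 ≤ L := (abs_le.1 hbd.1.1).2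
    have hnot : v ∉ (Λ δ).zdArcA := not_mem_zdArcA_of_near (hΩ δ) (hδ' δ) hδ0 hδs hLδ hL1 hAδ hsL hs hd
    refine ⟨?_, hnot⟩
    rcases hadmδ.zdBoundary_subset hv with h | h
    · exact absurd h hnot
    · exact h
  · intro v hv hs
    have hbd := (mem_zdBoundary_anchor_iff (hΩ δ) (hδ' δ) hδ0 hL2 hLδ hL1 v).1 hv
    have hnot : v ∉ (Λ δ).zdArcB :=
      not_mem_zdArcB_of_far (hΩ δ) (hδ' δ) hδ0 hδs hL8 hLδ hL1 hBδ hbd.1 hbd.2 hs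
    refine ⟨?_, hnot⟩
    rcases hadmδ.zdBoundary_subset hv with h | h
    · exact h
    · exact absurd h hnot

end S5

/-- **Registered one-line form `stub_anchor_lattice`** (helper of stub S5 `stub_anchoredWallFlux`, stub
GEOMETRY): moving a site by at most `2` in each coordinate moves its mesh point by less than `4δ` —
the `2`-neighbourhood of a site whose mesh point lies in the window `B(1 + i, ρ)` stays in
`B(1 + i, ρ + 4δ)`. [folklore] -/
theorem stub_anchor_lattice : ∀ (δ : ℝ), 0 < δ → ∀ (x y : Site 2) (ρ : ℝ), ‖meshPoint δ x - (1 + Complex.I)‖ < ρ → (∀ j, |y j - x j| ≤ 2) → ‖meshPoint δ y - (1 + Complex.I)‖ < ρ + 4 * δ := by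
  intro δ hδ x y ρ hx hy
  have h0 : |(y 0 : ℝ) - x 0| ≤ 2 := by exact_mod_cast hy 0
  have h1 : |(y 1 : ℝ) - x 1| ≤ 2 := by exact_mod_cast hy 1
  have hdiff : ‖meshPoint δ y - meshPoint δ x‖ ≤ 4 * δ := by
    refine (Complex.norm_le_abs_re_add_abs_im _).trans ?_
    rw [Complex.sub_re, Complex.sub_im, meshPoint_re, meshPoint_re, meshPoint_im, meshPoint_im,
      ← mul_sub, ← mul_sub, abs_mul, abs_mul, abs_of_pos hδ]
    nlinarith
  calc ‖meshPoint δ y - (1 + Complex.I)‖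
      = ‖(meshPoint δ x - (1 + Complex.I)) + (meshPoint δ y - meshPoint δ x)‖ := by ring_nf
    _ ≤ ‖meshPoint δ x - (1 + Complex.I)‖ + ‖meshPoint δ y - meshPoint δ x‖ := norm_add_le _ _
    _ < ρ + 4 * δ := by linarith

end Summit.CriticalPhenomena.CardyFormulaZ2.Theorems.ParafermionFamiliesToSLESix.StripAnchored

end
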